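import Literature.AlgebraicGeometry.Deformation.SmoothSchemeLiftObstructionCriterionGlueTransition
import Literature.AlgebraicGeometry.Deformation.SmoothSchemeLiftObstructionCechCocycle
import HarnessLib

/-!
# Gluing the lifted charts, III: the cocycle of the transition maps
# (Hartshorne, *Deformation Theory*, proof of Thm. 10.2 (a): «we can glue the schemes `U'_i` along these isomorphisms»)

HOME SEED (cell `hodgecm-mathlib`, F-11 (A3) F3b FILE 1c; provisional path `Deformation/SmoothSchemeLiftObstruction
CriterionGlueCocycle.lean`).  Theorems only; imports FILE 1b and F2 FILE A (`exists_baseChangeMap`, `exists_algEquiv_restrict`).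

For THREE charts `Spec (R ⊗_k Γ(V_i))` (`i = 0, 1, 2`) with opens `W₀₁, W₀₂` (chart `0`) and `W₁₂` (chart `1`) over the
pairwise intersections, chart ring maps `Λ_{ij}`, base changes `Φ` and lifted transition automorphisms `ψ₀₁, ψ₁₂, ψ₀₂`
(`≡ 1` modulo a nilpotent ideal `𝔫 ⊆ R`) whose restrictions `ρ` to `R ⊗_k Γ(V₀ ∩ V₁ ∩ V₂)` satisfy the COCYCLE CONDITION
`ρ₁₂ ∘ ρ₀₁ = ρ₀₂` in the exact ∀-form delivered by the HOME file F3a (`exists_cocycle_lifts_of_eq_cechMD1`), THIS FILE proves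
the TEST-MORPHISM COCYCLE of ★ `Morphisms/GlueDataOfOpens.OpensGlueDatum` for the transition maps
`t_{ij} = W_{ij}.toSpecΓ ≫ Spec (Λ_{ij} ∘ ψ_{ij}⁻¹ ∘ Φ_j)`:

* `comp_chartRingHom_of_transition` — the bookkeeping step: if `b : O → W₁₂` lies over `a ≫ t₀₁`, then
  `b^* ∘ Λ₁₂ = Λ_O ∘ ρ₀₁⁻¹ ∘ Φ` on `R ⊗_k Γ(V₁ ∩ V₂)` (ring maps out of the localization `Γ(V₀ ∩ V₁ ∩ V₂)` of `Γ(V₀ ∩ V₁)`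
  are determined on `Γ(V₀ ∩ V₁)`, Mathlib `IsAffineOpen.isLocalization_basicOpen`);
* **`transition_cocycle`** — `b ≫ t₁₂ = c ≫ t₀₂` for every open `O` of chart `0` with `a : O → W₀₁`, `c : O → W₀₂` over
  the inclusions and `b : O → W₁₂` over `a ≫ t₀₁`;
* `apply_eq_self_of_cocycle_self` — at `j = l = m` the cocycle condition forces `ψ j j = 1`.

HC_CM is proved only modulo the 7 printed citations until rung 0 closes — nothing here bears on a summit statement.

## References
* [Hartshorne2010] R. Hartshorne, *Deformation Theory*, GTM 257, Springer (2010): Thm. 10.2 (a) and its proof (p. 81).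
* [StacksProject] The Stacks Project, Tag 01JA (glueing schemes).
-/

noncomputable section

-- `TopCat.Presheaf`/`TopCat.Sheaf` are not reducible (as in Mathlib's `AlgebraicGeometry/Modules`).
set_option backward.isDefEq.respectTransparency false

open CategoryTheory AlgebraicGeometry Opposite TopologicalSpace
open scoped TensorProduct

universe u

namespace Literature.AlgebraicGeometry.Deformation

open Literature.AlgebraicGeometry.Motives

variable {k : Type u} [Field k] {X : Over (Spec (CommRingCat.of k))}
  [instΓ : ∀ W : X.left.Opens, Algebra k Γ(X.left, W)]
  (halg : ∀ (W : X.left.Opens) (s : k), algebraMap k Γ(X.left, W) s = (constToPresheaf X).app (op W) s)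
  {R : Type u} [CommRing R] [Algebra k R]

omit instΓ in
/-- Compatibility through `Φ` passes to inverses (the F2 lemma `algEquiv_restrict_inv`, `symm` form). [cite: Hartshorne2010, Thm. 10.2 (proof), p. 81] -/
private theorem algEquiv_restrict_inv' {A B : Type*} [Semiring A] [Semiring B] [Algebra R A] [Algebra R B]
    {Φ : A →ₐ[R] B} {u : A ≃ₐ[R] A} {uW : B ≃ₐ[R] B}
    (hu : ∀ x, uW (Φ x) = Φ (u x)) (x : A) : uW.symm (Φ x) = Φ (u.symm x) := by
  rw [AlgEquiv.symm_apply_eq, hu, AlgEquiv.apply_symm_apply]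


variable {V₀ V₁ V₂ : X.left.Opens} (hV₀ : IsAffineOpen V₀) (hV₁ : IsAffineOpen V₁) (h01 : IsAffineOpen (V₀ ⊓ V₁))
  (p₀ : Spec (CommRingCat.of (R ⊗[k] Γ(X.left, V₀))) ⟶ X.left)
  (hp₀ : p₀ = Spec.map (CommRingCat.ofHom
    (Algebra.TensorProduct.includeRight (R := k) (A := R) (B := Γ(X.left, V₀))).toRingHom) ≫ hV₀.fromSpec)
  (p₁ : Spec (CommRingCat.of (R ⊗[k] Γ(X.left, V₁))) ⟶ X.left)
  (hp₁ : p₁ = Spec.map (CommRingCat.ofHom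
    (Algebra.TensorProduct.includeRight (R := k) (A := R) (B := Γ(X.left, V₁))).toRingHom) ≫ hV₁.fromSpec)

set_option maxHeartbeats 400000 in
include halg hp₀ hp₁ h01 in
/-- **The chart ring map of the SECOND chart read through the transition map** (the key bookkeeping step of the
cocycle): if `b : O → W₁₂` lies over `a ≫ t₀₁` (`a : O → W₀₁` an inclusion of opens of the first chart,
`t₀₁ = Spec (Λ₀₁ ∘ ψ₀₁⁻¹ ∘ Φ)` the transition), then on `R ⊗_k Γ(V₁ ∩ V₂)`
`b^* ∘ Λ₁₂ = Λ_O ∘ ρ₀₁⁻¹ ∘ Φ_{12→V'}`, where `V' = V₀ ∩ V₁ ∩ V₂ = D(f₀₁)` is principal in `V₀ ∩ V₁`, `Λ_O` is the chart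
ring map of `O` over `V'` and `ρ₀₁` is the restriction of `ψ₀₁` to `R ⊗_k Γ(V')` (ring maps out of the localization
`Γ(V')` are determined on `Γ(V₀ ∩ V₁)`). [cite: Hartshorne2010, Thm. 10.2 (proof), p. 81] -/
theorem comp_chartRingHom_of_transition {V' : X.left.Opens} (f₀₁ : Γ(X.left, V₀ ⊓ V₁))
    (hV' : V' = X.left.basicOpen f₀₁) (hV'01 : V' ≤ V₀ ⊓ V₁) (hV'12 : V' ≤ V₁ ⊓ V₂)
    {W₀₁ : (Spec (CommRingCat.of (R ⊗[k] Γ(X.left, V₀)))).Opens} (hW₀₁ : ⊤ ≤ (W₀₁.ι ≫ p₀) ⁻¹ᵁ (V₀ ⊓ V₁))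
    {Λ₀₁ : R ⊗[k] Γ(X.left, V₀ ⊓ V₁) →+* Γ(↑W₀₁, ⊤)}
    (hΛ₀₁ : ∀ r : R, Λ₀₁ (r ⊗ₜ 1) =
      W₀₁.ι.appTop ((Scheme.ΓSpecIso (CommRingCat.of (R ⊗[k] Γ(X.left, V₀)))).inv (r ⊗ₜ 1)))
    (hΛ₀₁' : ∀ c : Γ(X.left, V₀ ⊓ V₁), Λ₀₁ (1 ⊗ₜ c) = (W₀₁.ι ≫ p₀).appLE (V₀ ⊓ V₁) ⊤ hW₀₁ c)
    {W₁₂ : (Spec (CommRingCat.of (R ⊗[k] Γ(X.left, V₁)))).Opens} (hW₁₂ : ⊤ ≤ (W₁₂.ι ≫ p₁) ⁻¹ᵁ (V₁ ⊓ V₂))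
    {Λ₁₂ : R ⊗[k] Γ(X.left, V₁ ⊓ V₂) →+* Γ(↑W₁₂, ⊤)}
    (hΛ₁₂ : ∀ r : R, Λ₁₂ (r ⊗ₜ 1) =
      W₁₂.ι.appTop ((Scheme.ΓSpecIso (CommRingCat.of (R ⊗[k] Γ(X.left, V₁)))).inv (r ⊗ₜ 1)))
    (hΛ₁₂' : ∀ c : Γ(X.left, V₁ ⊓ V₂), Λ₁₂ (1 ⊗ₜ c) = (W₁₂.ι ≫ p₁).appLE (V₁ ⊓ V₂) ⊤ hW₁₂ c)
    (ψ₀₁ : R ⊗[k] Γ(X.left, V₀ ⊓ V₁) ≃ₐ[R] R ⊗[k] Γ(X.left, V₀ ⊓ V₁)) (hψ₀₁ : ∀ x, IsNilpotent (ψ₀₁ x - x))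
    {Φ₁ : R ⊗[k] Γ(X.left, V₁) →ₐ[R] R ⊗[k] Γ(X.left, V₀ ⊓ V₁)}
    (hΦ₁ : ∀ a s, Φ₁ (a ⊗ₜ s) = a ⊗ₜ X.left.presheaf.map (homOfLE inf_le_right).op s)
    {O : (Spec (CommRingCat.of (R ⊗[k] Γ(X.left, V₀)))).Opens} (a : (O : Scheme.{u}) ⟶ W₀₁) (ha : a ≫ W₀₁.ι = O.ι)
    (b : (O : Scheme.{u}) ⟶ W₁₂)
    (hb : b ≫ W₁₂.ι = a ≫ (W₀₁ : Scheme.{u}).toSpecΓ ≫ Spec.map (CommRingCat.ofHom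
      (Λ₀₁.comp (ψ₀₁.symm.toAlgHom.toRingHom.comp Φ₁.toRingHom))))
    (hO : ⊤ ≤ (O.ι ≫ p₀) ⁻¹ᵁ V') {ΛO : R ⊗[k] Γ(X.left, V') →+* Γ(↑O, ⊤)}
    (hΛO : ∀ r : R, ΛO (r ⊗ₜ 1) =
      O.ι.appTop ((Scheme.ΓSpecIso (CommRingCat.of (R ⊗[k] Γ(X.left, V₀)))).inv (r ⊗ₜ 1)))
    (hΛO' : ∀ c : Γ(X.left, V'), ΛO (1 ⊗ₜ c) = (O.ι ≫ p₀).appLE V' ⊤ hO c)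
    {Φ₀₁' : R ⊗[k] Γ(X.left, V₀ ⊓ V₁) →ₐ[R] R ⊗[k] Γ(X.left, V')}
    (hΦ₀₁' : ∀ a s, Φ₀₁' (a ⊗ₜ s) = a ⊗ₜ X.left.presheaf.map (homOfLE hV'01).op s)
    {Φ₁₂' : R ⊗[k] Γ(X.left, V₁ ⊓ V₂) →ₐ[R] R ⊗[k] Γ(X.left, V')}
    (hΦ₁₂' : ∀ a s, Φ₁₂' (a ⊗ₜ s) = a ⊗ₜ X.left.presheaf.map (homOfLE hV'12).op s)
    {ρ₀₁ : R ⊗[k] Γ(X.left, V') ≃ₐ[R] R ⊗[k] Γ(X.left, V')} (hρ₀₁ : ∀ x, ρ₀₁ (Φ₀₁' x) = Φ₀₁' (ψ₀₁ x)) :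
    b.appTop.hom.comp Λ₁₂ = ΛO.comp (ρ₀₁.symm.toAlgHom.toRingHom.comp Φ₁₂'.toRingHom) := by
  subst hV'
  -- `O` lies over `V₀ ∩ V₁` as well (through `a`)
  have hO₀₁ : ⊤ ≤ (O.ι ≫ p₀) ⁻¹ᵁ (V₀ ⊓ V₁) := fun x hx => hV'01 (hO hx)
  obtain ⟨ΛO₀₁, hΛO₀₁, hΛO₀₁'⟩ := exists_chartRingHom halg hV₀ p₀ hp₀ O (inf_le_left : V₀ ⊓ V₁ ≤ V₀) hO₀₁
  -- the two readings of `Λ_O` on `V₀ ∩ V₁`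
  have eO₁ : ΛO.comp Φ₀₁'.toRingHom = ΛO₀₁ :=
    chartRingHom_comp_baseChange p₀ hV'01 hΛO₀₁ hΛO₀₁' hΛO hΛO' hΦ₀₁'
  have eO₂ : a.appTop.hom.comp Λ₀₁ = ΛO₀₁ := comp_chartRingHom p₀ a ha hΛ₀₁ hΛ₀₁' hΛO₀₁ hΛO₀₁'
  -- global sections of `b`, read through `hb` (morphism level)
  have hbtop : W₁₂.ι.appTop ≫ b.appTop = (Scheme.ΓSpecIso (CommRingCat.of (R ⊗[k] Γ(X.left, V₁)))).hom ≫
      CommRingCat.ofHom (Λ₀₁.comp (ψ₀₁.symm.toAlgHom.toRingHom.comp Φ₁.toRingHom)) ≫ a.appTop := by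
    rw [← Scheme.Hom.comp_appTop, hb, Scheme.Hom.comp_appTop, appTop_toSpecΓ_SpecMap, Category.assoc]
  have hbtop' : (Scheme.ΓSpecIso (CommRingCat.of (R ⊗[k] Γ(X.left, V₁)))).inv ≫ W₁₂.ι.appTop ≫ b.appTop =
      CommRingCat.ofHom (Λ₀₁.comp (ψ₀₁.symm.toAlgHom.toRingHom.comp Φ₁.toRingHom)) ≫ a.appTop := by
    rw [hbtop, Iso.inv_hom_id_assoc]
  have haO : W₀₁.ι.appTop ≫ a.appTop = O.ι.appTop := by rw [← Scheme.Hom.comp_appTop, ha]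
  refine ringHom_ext_tmul (fun r => ?_) (fun c => ?_)
  · -- the `R`-part: both sides are the structure constants of `O`
    have e12 : ρ₀₁.symm.toAlgHom.toRingHom (Φ₁₂' (r ⊗ₜ 1)) = r ⊗ₜ 1 := by
      rw [baseChangeMap_tmul_one hV'12 hΦ₁₂' r]
      exact algEquiv_tmul_one ρ₀₁.symm r
    have e34 : ψ₀₁.symm.toAlgHom.toRingHom (Φ₁ (r ⊗ₜ 1)) = r ⊗ₜ 1 := by
      rw [baseChangeMap_tmul_one inf_le_right hΦ₁ r]
      exact algEquiv_tmul_one ψ₀₁.symm r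
    have lhs : b.appTop (Λ₁₂ (r ⊗ₜ 1)) =
        O.ι.appTop ((Scheme.ΓSpecIso (CommRingCat.of (R ⊗[k] Γ(X.left, V₀)))).inv (r ⊗ₜ 1)) :=
      calc b.appTop (Λ₁₂ (r ⊗ₜ 1))
          = b.appTop (W₁₂.ι.appTop ((Scheme.ΓSpecIso (CommRingCat.of (R ⊗[k] Γ(X.left, V₁)))).inv (r ⊗ₜ 1))) :=
            congrArg (fun y => b.appTop y) (hΛ₁₂ r)
        _ = ((Scheme.ΓSpecIso (CommRingCat.of (R ⊗[k] Γ(X.left, V₁)))).inv ≫ W₁₂.ι.appTop ≫ b.appTop)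
              (r ⊗ₜ 1) := rfl
        _ = (CommRingCat.ofHom (Λ₀₁.comp (ψ₀₁.symm.toAlgHom.toRingHom.comp Φ₁.toRingHom)) ≫ a.appTop)
              (r ⊗ₜ 1) := by rw [hbtop']
        _ = a.appTop (Λ₀₁ (ψ₀₁.symm.toAlgHom.toRingHom (Φ₁ (r ⊗ₜ 1)))) := rfl
        _ = a.appTop (Λ₀₁ (r ⊗ₜ 1)) := congrArg (fun y => a.appTop (Λ₀₁ y)) e34
        _ = a.appTop (W₀₁.ι.appTop ((Scheme.ΓSpecIso (CommRingCat.of (R ⊗[k] Γ(X.left, V₀)))).inv (r ⊗ₜ 1))) :=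
            congrArg (fun y => a.appTop y) (hΛ₀₁ r)
        _ = (W₀₁.ι.appTop ≫ a.appTop) ((Scheme.ΓSpecIso (CommRingCat.of (R ⊗[k] Γ(X.left, V₀)))).inv (r ⊗ₜ 1)) :=
            rfl
        _ = O.ι.appTop ((Scheme.ΓSpecIso (CommRingCat.of (R ⊗[k] Γ(X.left, V₀)))).inv (r ⊗ₜ 1)) := by
            rw [haO]
    have rhs : ΛO (ρ₀₁.symm.toAlgHom.toRingHom (Φ₁₂' (r ⊗ₜ 1))) =
        O.ι.appTop ((Scheme.ΓSpecIso (CommRingCat.of (R ⊗[k] Γ(X.left, V₀)))).inv (r ⊗ₜ 1)) := by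
      rw [e12]
      exact hΛO r
    exact lhs.trans rhs.symm
  · -- the `Γ(V₁ ∩ V₂)`-part: ring maps out of the localization `Γ(V')` are determined on `Γ(V₀ ∩ V₁)`
    -- `F := b ≫ W₁₂.ι ≫ p₁` in normal form through `V₀ ∩ V₁ ↪ X`, and its underlying map
    have e1 : b ≫ W₁₂.ι ≫ p₁ = a ≫ ((W₀₁ : Scheme.{u}).toSpecΓ ≫ Spec.map (CommRingCat.ofHom
        (Λ₀₁.comp (ψ₀₁.symm.toAlgHom.toRingHom.comp Φ₁.toRingHom)))) ≫ p₁ :=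
      ((Category.assoc _ _ _).symm.trans (congrArg (· ≫ p₁) hb)).trans (Category.assoc _ _ _)
    have eT : ((W₀₁ : Scheme.{u}).toSpecΓ ≫ Spec.map (CommRingCat.ofHom
        (Λ₀₁.comp (ψ₀₁.symm.toAlgHom.toRingHom.comp Φ₁.toRingHom)))) ≫ p₁ =
        (W₀₁ : Scheme.{u}).toSpecΓ ≫ Spec.map (CommRingCat.ofHom ((Λ₀₁.comp ψ₀₁.symm.toAlgHom.toRingHom).comp
          (Algebra.TensorProduct.includeRight (R := k) (A := R) (B := Γ(X.left, V₀ ⊓ V₁))).toRingHom)) ≫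
          h01.fromSpec :=
      toSpecΓ_SpecMap_comp_chart hV₁ h01 p₁ hp₁ (Λ₀₁.comp ψ₀₁.symm.toAlgHom.toRingHom) hΦ₁
    have eF : b ≫ W₁₂.ι ≫ p₁ = (O : Scheme.{u}).toSpecΓ ≫ Spec.map (CommRingCat.ofHom
        ((Λ₀₁.comp ψ₀₁.symm.toAlgHom.toRingHom).comp
          (Algebra.TensorProduct.includeRight (R := k) (A := R) (B := Γ(X.left, V₀ ⊓ V₁))).toRingHom) ≫
          a.appTop) ≫ h01.fromSpec := by
      exact (e1.trans (congrArg (a ≫ ·) eT)).trans (comp_toSpecΓ_SpecMap_assoc a _ _)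
    have hT := chart_transition_base hV₀ hV₁ h01 p₀ hp₀ p₁ hp₁ hW₀₁ hΛ₀₁' ψ₀₁ hψ₀₁ hΦ₁
    have hF : (b ≫ W₁₂.ι ≫ p₁).base = (O.ι ≫ p₀).base :=
      calc (b ≫ W₁₂.ι ≫ p₁).base
          = (a ≫ ((W₀₁ : Scheme.{u}).toSpecΓ ≫ Spec.map (CommRingCat.ofHom
              (Λ₀₁.comp (ψ₀₁.symm.toAlgHom.toRingHom.comp Φ₁.toRingHom)))) ≫ p₁).base :=
            congrArg (fun f => f.base) e1
        _ = a.base ≫ (((W₀₁ : Scheme.{u}).toSpecΓ ≫ Spec.map (CommRingCat.ofHom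
              (Λ₀₁.comp (ψ₀₁.symm.toAlgHom.toRingHom.comp Φ₁.toRingHom)))) ≫ p₁).base := Scheme.Hom.comp_base _ _
        _ = a.base ≫ (W₀₁.ι ≫ p₀).base := by rw [hT]
        _ = ((a ≫ W₀₁.ι) ≫ p₀).base := by simp only [Scheme.Hom.comp_base, Category.assoc]
        _ = (O.ι ≫ p₀).base := by rw [ha]
    have hpre : (b ≫ W₁₂.ι ≫ p₁) ⁻¹ᵁ X.left.basicOpen f₀₁ = (O.ι ≫ p₀) ⁻¹ᵁ X.left.basicOpen f₀₁ := by
      rw [hF]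
    have hα : ⊤ ≤ (b ≫ W₁₂.ι ≫ p₁) ⁻¹ᵁ X.left.basicOpen f₀₁ := by
      rw [hpre]
      exact hO
    have h₁ : ⊤ ≤ (b ≫ W₁₂.ι ≫ p₁) ⁻¹ᵁ (V₁ ⊓ V₂) := fun x hx => hV'12 (hα hx)
    have E1 : (W₁₂.ι ≫ p₁).appLE (V₁ ⊓ V₂) ⊤ hW₁₂ ≫ b.appTop = (b ≫ W₁₂.ι ≫ p₁).appLE (V₁ ⊓ V₂) ⊤ h₁ := by
      rw [Scheme.Hom.appTop, Scheme.Hom.app_eq_appLE, Scheme.Hom.appLE_comp_appLE]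
      rfl
    have E2 : X.left.presheaf.map (homOfLE hV'12).op ≫ (b ≫ W₁₂.ι ≫ p₁).appLE (X.left.basicOpen f₀₁) ⊤ hα =
        (b ≫ W₁₂.ι ≫ p₁).appLE (V₁ ⊓ V₂) ⊤ h₁ := Scheme.Hom.map_appLE _ _ _
    -- the two ring maps `Γ(V') → Γ(O)` agree on `Γ(V₀ ∩ V₁)`, hence everywhere
    have hαβ : ((b ≫ W₁₂.ι ≫ p₁).appLE (X.left.basicOpen f₀₁) ⊤ hα).hom =
        ΛO.comp (ρ₀₁.symm.toAlgHom.toRingHom.comp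
          (Algebra.TensorProduct.includeRight (R := k) (A := R) (B := Γ(X.left, X.left.basicOpen f₀₁))).toRingHom) := by
      letI alg : Algebra Γ(X.left, V₀ ⊓ V₁) Γ(X.left, X.left.basicOpen f₀₁) :=
        (X.left.presheaf.map (homOfLE hV'01).op).hom.toAlgebra
      haveI : IsLocalization.Away f₀₁ Γ(X.left, X.left.basicOpen f₀₁) := h01.isLocalization_basicOpen f₀₁
      refine IsLocalization.ringHom_ext (Submonoid.powers f₀₁) (RingHom.ext fun d => ?_)
      have h₂ : ⊤ ≤ (b ≫ W₁₂.ι ≫ p₁) ⁻¹ᵁ (V₀ ⊓ V₁) := fun x hx => hV'01 (hα hx)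
      have E3 : X.left.presheaf.map (homOfLE hV'01).op ≫ (b ≫ W₁₂.ι ≫ p₁).appLE (X.left.basicOpen f₀₁) ⊤ hα =
          (b ≫ W₁₂.ι ≫ p₁).appLE (V₀ ⊓ V₁) ⊤ h₂ := Scheme.Hom.map_appLE _ _ _
      have E4 : (b ≫ W₁₂.ι ≫ p₁).appLE (V₀ ⊓ V₁) ⊤ h₂ = CommRingCat.ofHom
          ((Λ₀₁.comp ψ₀₁.symm.toAlgHom.toRingHom).comp
            (Algebra.TensorProduct.includeRight (R := k) (A := R) (B := Γ(X.left, V₀ ⊓ V₁))).toRingHom) ≫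
            a.appTop := by
        rw [appLE_eq_of_eq eF, appLE_toSpecΓ_SpecMap_fromSpec]
      calc ((X.left.presheaf.map (homOfLE hV'01).op ≫
              (b ≫ W₁₂.ι ≫ p₁).appLE (X.left.basicOpen f₀₁) ⊤ hα)) d
          = ((b ≫ W₁₂.ι ≫ p₁).appLE (V₀ ⊓ V₁) ⊤ h₂) d :=
            congrArg (fun φ : Γ(X.left, V₀ ⊓ V₁) ⟶ Γ(↑O, ⊤) => φ d) E3
        _ = (CommRingCat.ofHom ((Λ₀₁.comp ψ₀₁.symm.toAlgHom.toRingHom).comp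
              (Algebra.TensorProduct.includeRight (R := k) (A := R) (B := Γ(X.left, V₀ ⊓ V₁))).toRingHom) ≫
              a.appTop) d :=
            congrArg (fun φ : Γ(X.left, V₀ ⊓ V₁) ⟶ Γ(↑O, ⊤) => φ d) E4
        _ = a.appTop ((CommRingCat.ofHom ((Λ₀₁.comp ψ₀₁.symm.toAlgHom.toRingHom).comp
              (Algebra.TensorProduct.includeRight (R := k) (A := R) (B := Γ(X.left, V₀ ⊓ V₁))).toRingHom)) d) :=
            CommRingCat.comp_apply _ _ _
        _ = a.appTop (Λ₀₁ (ψ₀₁.symm.toAlgHom.toRingHom (1 ⊗ₜ d))) := rfl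
        _ = ΛO₀₁ (ψ₀₁.symm.toAlgHom.toRingHom (1 ⊗ₜ d)) := RingHom.congr_fun eO₂ _
        _ = ΛO (Φ₀₁' (ψ₀₁.symm.toAlgHom.toRingHom (1 ⊗ₜ d))) := (RingHom.congr_fun eO₁ _).symm
        _ = ΛO (ρ₀₁.symm.toAlgHom.toRingHom (Φ₀₁' (1 ⊗ₜ d))) :=
            congrArg (fun y => ΛO y) (algEquiv_restrict_inv' hρ₀₁ _).symm
        _ = ΛO (ρ₀₁.symm.toAlgHom.toRingHom (1 ⊗ₜ X.left.presheaf.map (homOfLE hV'01).op d)) :=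
            congrArg (fun y => ΛO (ρ₀₁.symm.toAlgHom.toRingHom y)) (hΦ₀₁' 1 d)
    -- assemble
    calc (b.appTop.hom.comp Λ₁₂) (1 ⊗ₜ c)
        = b.appTop ((W₁₂.ι ≫ p₁).appLE (V₁ ⊓ V₂) ⊤ hW₁₂ c) := congrArg (fun y => b.appTop y) (hΛ₁₂' c)
      _ = ((W₁₂.ι ≫ p₁).appLE (V₁ ⊓ V₂) ⊤ hW₁₂ ≫ b.appTop) c := (CommRingCat.comp_apply _ _ _).symm
      _ = ((b ≫ W₁₂.ι ≫ p₁).appLE (V₁ ⊓ V₂) ⊤ h₁) c :=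
          congrArg (fun φ : Γ(X.left, V₁ ⊓ V₂) ⟶ Γ(↑O, ⊤) => φ c) E1
      _ = (X.left.presheaf.map (homOfLE hV'12).op ≫
            (b ≫ W₁₂.ι ≫ p₁).appLE (X.left.basicOpen f₀₁) ⊤ hα) c :=
          congrArg (fun φ : Γ(X.left, V₁ ⊓ V₂) ⟶ Γ(↑O, ⊤) => φ c) E2.symm
      _ = ((b ≫ W₁₂.ι ≫ p₁).appLE (X.left.basicOpen f₀₁) ⊤ hα).hom
            (X.left.presheaf.map (homOfLE hV'12).op c) := CommRingCat.comp_apply _ _ _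
      _ = (ΛO.comp (ρ₀₁.symm.toAlgHom.toRingHom.comp
            (Algebra.TensorProduct.includeRight (R := k) (A := R)
              (B := Γ(X.left, X.left.basicOpen f₀₁))).toRingHom))
            (X.left.presheaf.map (homOfLE hV'12).op c) := RingHom.congr_fun hαβ _
      _ = ΛO (ρ₀₁.symm.toAlgHom.toRingHom (1 ⊗ₜ X.left.presheaf.map (homOfLE hV'12).op c)) := rfl
      _ = ΛO (ρ₀₁.symm.toAlgHom.toRingHom (Φ₁₂' (1 ⊗ₜ c))) :=
          congrArg (fun y => ΛO (ρ₀₁.symm.toAlgHom.toRingHom y)) (hΦ₁₂' 1 c).symm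

variable (hV₂ : IsAffineOpen V₂) (h12 : IsAffineOpen (V₁ ⊓ V₂)) (h02 : IsAffineOpen (V₀ ⊓ V₂))
  (p₂ : Spec (CommRingCat.of (R ⊗[k] Γ(X.left, V₂))) ⟶ X.left)
  (hp₂ : p₂ = Spec.map (CommRingCat.ofHom
    (Algebra.TensorProduct.includeRight (R := k) (A := R) (B := Γ(X.left, V₂))).toRingHom) ≫ hV₂.fromSpec)

set_option maxHeartbeats 800000 in
include halg hp₀ hp₁ h01 h12 h02 in
/-- **THE COCYCLE OF THE TRANSITION MAPS** («… and then we can glue the schemes `U'_i` along these isomorphisms»):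
for three charts `Spec (R ⊗_k Γ(V_i))` of a trivial deformation of the closed fibre, opens `W₀₁, W₀₂` (chart `0`) and
`W₁₂` (chart `1`) over the pairwise intersections, lifted transition automorphisms `ψ₀₁, ψ₁₂, ψ₀₂` (`≡ 1` modulo a
nilpotent ideal `𝔫`) whose restrictions to `R ⊗_k Γ(V₀ ∩ V₁ ∩ V₂)` satisfy the COCYCLE CONDITION `ρ₁₂ ∘ ρ₀₁ = ρ₀₂`
(F3a's output), the transition maps `t_{ij} = Spec (Λ_{ij} ∘ ψ_{ij}⁻¹ ∘ Φ_j) : W_{ij} → Spec (R ⊗_k Γ(V_j))` satisfy the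
test-morphism cocycle of ★ `Morphisms/GlueDataOfOpens.OpensGlueDatum`: `b ≫ t₁₂ = c ≫ t₀₂` for every open `O` of
chart `0` with `a : O → W₀₁`, `c : O → W₀₂` over the inclusions and `b : O → W₁₂` over `a ≫ t₀₁`.
[cite: Hartshorne2010, Thm. 10.2 (proof), p. 81] [cite: StacksProject, Tag 01JA] -/
theorem transition_cocycle (𝔫 : Ideal R) (h𝔫 : IsNilpotent 𝔫)
    (f₀₁ : Γ(X.left, V₀ ⊓ V₁)) (hf₀₁ : V₀ ⊓ V₁ ⊓ V₂ = X.left.basicOpen f₀₁)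
    (f₁₂ : Γ(X.left, V₁ ⊓ V₂)) (hf₁₂ : V₀ ⊓ V₁ ⊓ V₂ = X.left.basicOpen f₁₂)
    (f₀₂ : Γ(X.left, V₀ ⊓ V₂)) (hf₀₂ : V₀ ⊓ V₁ ⊓ V₂ = X.left.basicOpen f₀₂)
    {W₀₁ : (Spec (CommRingCat.of (R ⊗[k] Γ(X.left, V₀)))).Opens} (hW₀₁ : ⊤ ≤ (W₀₁.ι ≫ p₀) ⁻¹ᵁ (V₀ ⊓ V₁))
    {Λ₀₁ : R ⊗[k] Γ(X.left, V₀ ⊓ V₁) →+* Γ(↑W₀₁, ⊤)}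
    (hΛ₀₁ : ∀ r : R, Λ₀₁ (r ⊗ₜ 1) =
      W₀₁.ι.appTop ((Scheme.ΓSpecIso (CommRingCat.of (R ⊗[k] Γ(X.left, V₀)))).inv (r ⊗ₜ 1)))
    (hΛ₀₁' : ∀ c : Γ(X.left, V₀ ⊓ V₁), Λ₀₁ (1 ⊗ₜ c) = (W₀₁.ι ≫ p₀).appLE (V₀ ⊓ V₁) ⊤ hW₀₁ c)
    {W₁₂ : (Spec (CommRingCat.of (R ⊗[k] Γ(X.left, V₁)))).Opens} (hW₁₂ : ⊤ ≤ (W₁₂.ι ≫ p₁) ⁻¹ᵁ (V₁ ⊓ V₂))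
    {Λ₁₂ : R ⊗[k] Γ(X.left, V₁ ⊓ V₂) →+* Γ(↑W₁₂, ⊤)}
    (hΛ₁₂ : ∀ r : R, Λ₁₂ (r ⊗ₜ 1) =
      W₁₂.ι.appTop ((Scheme.ΓSpecIso (CommRingCat.of (R ⊗[k] Γ(X.left, V₁)))).inv (r ⊗ₜ 1)))
    (hΛ₁₂' : ∀ c : Γ(X.left, V₁ ⊓ V₂), Λ₁₂ (1 ⊗ₜ c) = (W₁₂.ι ≫ p₁).appLE (V₁ ⊓ V₂) ⊤ hW₁₂ c)
    {W₀₂ : (Spec (CommRingCat.of (R ⊗[k] Γ(X.left, V₀)))).Opens} (hW₀₂ : ⊤ ≤ (W₀₂.ι ≫ p₀) ⁻¹ᵁ (V₀ ⊓ V₂))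
    {Λ₀₂ : R ⊗[k] Γ(X.left, V₀ ⊓ V₂) →+* Γ(↑W₀₂, ⊤)}
    (hΛ₀₂ : ∀ r : R, Λ₀₂ (r ⊗ₜ 1) =
      W₀₂.ι.appTop ((Scheme.ΓSpecIso (CommRingCat.of (R ⊗[k] Γ(X.left, V₀)))).inv (r ⊗ₜ 1)))
    (hΛ₀₂' : ∀ c : Γ(X.left, V₀ ⊓ V₂), Λ₀₂ (1 ⊗ₜ c) = (W₀₂.ι ≫ p₀).appLE (V₀ ⊓ V₂) ⊤ hW₀₂ c)
    (ψ₀₁ : R ⊗[k] Γ(X.left, V₀ ⊓ V₁) ≃ₐ[R] R ⊗[k] Γ(X.left, V₀ ⊓ V₁))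
    (hψ₀₁ : ∀ x, ψ₀₁ x - x ∈ 𝔫 • (⊤ : Submodule R (R ⊗[k] Γ(X.left, V₀ ⊓ V₁))))
    (ψ₁₂ : R ⊗[k] Γ(X.left, V₁ ⊓ V₂) ≃ₐ[R] R ⊗[k] Γ(X.left, V₁ ⊓ V₂))
    (hψ₁₂ : ∀ x, ψ₁₂ x - x ∈ 𝔫 • (⊤ : Submodule R (R ⊗[k] Γ(X.left, V₁ ⊓ V₂))))
    (ψ₀₂ : R ⊗[k] Γ(X.left, V₀ ⊓ V₂) ≃ₐ[R] R ⊗[k] Γ(X.left, V₀ ⊓ V₂))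
    (hψ₀₂ : ∀ x, ψ₀₂ x - x ∈ 𝔫 • (⊤ : Submodule R (R ⊗[k] Γ(X.left, V₀ ⊓ V₂))))
    {Φ₁ : R ⊗[k] Γ(X.left, V₁) →ₐ[R] R ⊗[k] Γ(X.left, V₀ ⊓ V₁)}
    (hΦ₁ : ∀ a s, Φ₁ (a ⊗ₜ s) = a ⊗ₜ X.left.presheaf.map (homOfLE inf_le_right).op s)
    {Φ₂ : R ⊗[k] Γ(X.left, V₂) →ₐ[R] R ⊗[k] Γ(X.left, V₁ ⊓ V₂)}
    (hΦ₂ : ∀ a s, Φ₂ (a ⊗ₜ s) = a ⊗ₜ X.left.presheaf.map (homOfLE inf_le_right).op s)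
    {Φ₂' : R ⊗[k] Γ(X.left, V₂) →ₐ[R] R ⊗[k] Γ(X.left, V₀ ⊓ V₂)}
    (hΦ₂' : ∀ a s, Φ₂' (a ⊗ₜ s) = a ⊗ₜ X.left.presheaf.map (homOfLE inf_le_right).op s)
    (hcoc : ∀
      (Φjl : R ⊗[k] Γ(X.left, V₀ ⊓ V₁) →ₐ[R] R ⊗[k] Γ(X.left, V₀ ⊓ V₁ ⊓ V₂))
      (_ : ∀ a s, Φjl (a ⊗ₜ s) = a ⊗ₜ X.left.presheaf.map (homOfLE inf_le_left).op s)
      (Φlm : R ⊗[k] Γ(X.left, V₁ ⊓ V₂) →ₐ[R] R ⊗[k] Γ(X.left, V₀ ⊓ V₁ ⊓ V₂))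
      (_ : ∀ a s, Φlm (a ⊗ₜ s) = a ⊗ₜ X.left.presheaf.map
        (homOfLE (le_inf (inf_le_left.trans inf_le_right) inf_le_right)).op s)
      (Φjm : R ⊗[k] Γ(X.left, V₀ ⊓ V₂) →ₐ[R] R ⊗[k] Γ(X.left, V₀ ⊓ V₁ ⊓ V₂))
      (_ : ∀ a s, Φjm (a ⊗ₜ s) = a ⊗ₜ X.left.presheaf.map
        (homOfLE (le_inf (inf_le_left.trans inf_le_left) inf_le_right)).op s)
      (ρjl ρlm ρjm : R ⊗[k] Γ(X.left, V₀ ⊓ V₁ ⊓ V₂) ≃ₐ[R] R ⊗[k] Γ(X.left, V₀ ⊓ V₁ ⊓ V₂)),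
      (∀ x, ρjl (Φjl x) = Φjl (ψ₀₁ x)) → (∀ x, ρlm (Φlm x) = Φlm (ψ₁₂ x)) →
      (∀ x, ρjm (Φjm x) = Φjm (ψ₀₂ x)) → ρlm * ρjl = ρjm)
    {O : (Spec (CommRingCat.of (R ⊗[k] Γ(X.left, V₀)))).Opens} (a : (O : Scheme.{u}) ⟶ W₀₁) (ha : a ≫ W₀₁.ι = O.ι)
    (b : (O : Scheme.{u}) ⟶ W₁₂)
    (hb : b ≫ W₁₂.ι = a ≫ (W₀₁ : Scheme.{u}).toSpecΓ ≫ Spec.map (CommRingCat.ofHom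
      (Λ₀₁.comp (ψ₀₁.symm.toAlgHom.toRingHom.comp Φ₁.toRingHom))))
    (c : (O : Scheme.{u}) ⟶ W₀₂) (hc : c ≫ W₀₂.ι = O.ι) :
    b ≫ (W₁₂ : Scheme.{u}).toSpecΓ ≫ Spec.map (CommRingCat.ofHom
        (Λ₁₂.comp (ψ₁₂.symm.toAlgHom.toRingHom.comp Φ₂.toRingHom))) =
      c ≫ (W₀₂ : Scheme.{u}).toSpecΓ ≫ Spec.map (CommRingCat.ofHom
        (Λ₀₂.comp (ψ₀₂.symm.toAlgHom.toRingHom.comp Φ₂'.toRingHom))) := by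
  have hV'01 : V₀ ⊓ V₁ ⊓ V₂ ≤ V₀ ⊓ V₁ := inf_le_left
  have hV'12 : V₀ ⊓ V₁ ⊓ V₂ ≤ V₁ ⊓ V₂ := le_inf (inf_le_left.trans inf_le_right) inf_le_right
  have hV'02 : V₀ ⊓ V₁ ⊓ V₂ ≤ V₀ ⊓ V₂ := le_inf (inf_le_left.trans inf_le_left) inf_le_right
  have hV'2 : V₀ ⊓ V₁ ⊓ V₂ ≤ V₂ := inf_le_right
  -- base changes to the triple intersection and the restrictions of the `ψ`'s
  obtain ⟨Φ₀₁', hΦ₀₁'⟩ := exists_baseChangeMap (A' := R) halg (V₀ ⊓ V₁) (V₀ ⊓ V₁ ⊓ V₂) hV'01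
  obtain ⟨Φ₁₂', hΦ₁₂'⟩ := exists_baseChangeMap (A' := R) halg (V₁ ⊓ V₂) (V₀ ⊓ V₁ ⊓ V₂) hV'12
  obtain ⟨Φ₀₂', hΦ₀₂'⟩ := exists_baseChangeMap (A' := R) halg (V₀ ⊓ V₂) (V₀ ⊓ V₁ ⊓ V₂) hV'02
  obtain ⟨Φ₂'', hΦ₂''⟩ := exists_baseChangeMap (A' := R) halg V₂ (V₀ ⊓ V₁ ⊓ V₂) hV'2
  obtain ⟨ρ₀₁, hρ₀₁, -⟩ := exists_algEquiv_restrict (A' := R) halg 𝔫 (V := V₀ ⊓ V₁) (W := V₀ ⊓ V₁ ⊓ V₂) h01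
    f₀₁ hf₀₁ hV'01 h𝔫 ψ₀₁ hψ₀₁ (Φ := Φ₀₁') hΦ₀₁'
  obtain ⟨ρ₁₂, hρ₁₂, -⟩ := exists_algEquiv_restrict (A' := R) halg 𝔫 (V := V₁ ⊓ V₂) (W := V₀ ⊓ V₁ ⊓ V₂) h12
    f₁₂ hf₁₂ hV'12 h𝔫 ψ₁₂ hψ₁₂ (Φ := Φ₁₂') hΦ₁₂'
  obtain ⟨ρ₀₂, hρ₀₂, -⟩ := exists_algEquiv_restrict (A' := R) halg 𝔫 (V := V₀ ⊓ V₂) (W := V₀ ⊓ V₁ ⊓ V₂) h02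
    f₀₂ hf₀₂ hV'02 h𝔫 ψ₀₂ hψ₀₂ (Φ := Φ₀₂') hΦ₀₂'
  have hρ : ρ₁₂ * ρ₀₁ = ρ₀₂ := hcoc Φ₀₁' hΦ₀₁' Φ₁₂' hΦ₁₂' Φ₀₂' hΦ₀₂' ρ₀₁ ρ₁₂ ρ₀₂ hρ₀₁ hρ₁₂ hρ₀₂
  -- `O` lies over the triple intersection
  have hO₀₁ : (O.ι ≫ p₀) ⁻¹ᵁ (V₀ ⊓ V₁) = ⊤ := by
    rw [← ha, Category.assoc, Scheme.Hom.comp_preimage, top_le_iff.mp hW₀₁]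
    rfl
  have hO₀₂ : (O.ι ≫ p₀) ⁻¹ᵁ (V₀ ⊓ V₂) = ⊤ := by
    rw [← hc, Category.assoc, Scheme.Hom.comp_preimage, top_le_iff.mp hW₀₂]
    rfl
  have hO : ⊤ ≤ (O.ι ≫ p₀) ⁻¹ᵁ (V₀ ⊓ V₁ ⊓ V₂) := by
    intro x _
    have h₁ : x ∈ (O.ι ≫ p₀) ⁻¹ᵁ (V₀ ⊓ V₁) := by rw [hO₀₁]; trivial
    have h₂ : x ∈ (O.ι ≫ p₀) ⁻¹ᵁ (V₀ ⊓ V₂) := by rw [hO₀₂]; trivial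
    exact ⟨h₁, h₂.2⟩
  have hO₀₂' : ⊤ ≤ (O.ι ≫ p₀) ⁻¹ᵁ (V₀ ⊓ V₂) := by rw [hO₀₂]
  obtain ⟨ΛO, hΛO, hΛO'⟩ := exists_chartRingHom halg hV₀ p₀ hp₀ O
    ((inf_le_left.trans inf_le_left : V₀ ⊓ V₁ ⊓ V₂ ≤ V₀)) hO
  obtain ⟨ΛO₀₂, hΛO₀₂, hΛO₀₂'⟩ := exists_chartRingHom halg hV₀ p₀ hp₀ O (inf_le_left : V₀ ⊓ V₂ ≤ V₀) hO₀₂'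
  -- Claim B: the second chart's ring map read through the transition `t₀₁`
  have hψ₀₁' : ∀ x, IsNilpotent (ψ₀₁ x - x) := fun x =>
    SmoothAffineDeformation.isNilpotent_of_mem_smul_top 𝔫 h𝔫 (hψ₀₁ x)
  have hB := comp_chartRingHom_of_transition halg hV₀ hV₁ h01 p₀ hp₀ p₁ hp₁ f₀₁ hf₀₁ hV'01 hV'12 hW₀₁ hΛ₀₁ hΛ₀₁'
    hW₁₂ hΛ₁₂ hΛ₁₂' ψ₀₁ hψ₀₁' hΦ₁ a ha b hb hO hΛO hΛO' hΦ₀₁' hΦ₁₂' hρ₀₁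
  -- Claim C: the chart ring map of `W₀₂` restricted to `O`
  have hC : c.appTop.hom.comp Λ₀₂ = ΛO.comp Φ₀₂'.toRingHom :=
    (comp_chartRingHom p₀ c hc hΛ₀₂ hΛ₀₂' hΛO₀₂ hΛO₀₂').trans
      (chartRingHom_comp_baseChange p₀ hV'02 hΛO₀₂ hΛO₀₂' hΛO hΛO' hΦ₀₂').symm
  -- both sides in normal form over `O`; compare the ring maps
  rw [comp_toSpecΓ_SpecMap, comp_toSpecΓ_SpecMap]
  apply toSpecΓ_SpecMap_congr
  apply CommRingCat.hom_ext
  rw [CommRingCat.hom_comp, CommRingCat.hom_comp, CommRingCat.hom_ofHom, CommRingCat.hom_ofHom]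
  change (b.appTop.hom.comp Λ₁₂).comp (ψ₁₂.symm.toAlgHom.toRingHom.comp Φ₂.toRingHom) =
    (c.appTop.hom.comp Λ₀₂).comp (ψ₀₂.symm.toAlgHom.toRingHom.comp Φ₂'.toRingHom)
  rw [hB, hC]
  subst hρ
  refine RingHom.ext fun x => ?_
  change ΛO (ρ₀₁.symm (Φ₁₂' (ψ₁₂.symm (Φ₂ x)))) = ΛO (Φ₀₂' (ψ₀₂.symm (Φ₂' x)))
  rw [← algEquiv_restrict_inv' hρ₁₂, ← algEquiv_restrict_inv' hρ₀₂,
    baseChangeMap_comp_apply (inf_le_right : V₁ ⊓ V₂ ≤ V₂) hV'12 hΦ₂ hΦ₁₂' hΦ₂'',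
    baseChangeMap_comp_apply (inf_le_right : V₀ ⊓ V₂ ≤ V₂) hV'02 hΦ₂' hΦ₀₂' hΦ₂'']
  rfl
include halg in
/-- **The cocycle condition on `U j ∩ U j ∩ U j` forces `ψ j j = 1`**: if the restriction `ρ` of `ψ` along the base change
`R ⊗_k Γ(V₀ ∩ V₀) → R ⊗_k Γ(V₀ ∩ V₀ ∩ V₀)` satisfies `ρ ∘ ρ = ρ` (F3a's cocycle clause at `j = l = m`), then
`ψ = 1`. [cite: StacksProject, Tag 01JA] [cite: Hartshorne2010, Thm. 10.2 (proof), p. 81] -/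
theorem apply_eq_self_of_cocycle_self (𝔫 : Ideal R) (h𝔫 : IsNilpotent 𝔫) (h00 : IsAffineOpen (V₀ ⊓ V₀))
    (f : Γ(X.left, V₀ ⊓ V₀)) (hf : V₀ ⊓ V₀ ⊓ V₀ = X.left.basicOpen f)
    (ψ : R ⊗[k] Γ(X.left, V₀ ⊓ V₀) ≃ₐ[R] R ⊗[k] Γ(X.left, V₀ ⊓ V₀))
    (hψ : ∀ x, ψ x - x ∈ 𝔫 • (⊤ : Submodule R (R ⊗[k] Γ(X.left, V₀ ⊓ V₀))))
    (hcoc : ∀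
      (Φjl : R ⊗[k] Γ(X.left, V₀ ⊓ V₀) →ₐ[R] R ⊗[k] Γ(X.left, V₀ ⊓ V₀ ⊓ V₀))
      (_ : ∀ a s, Φjl (a ⊗ₜ s) = a ⊗ₜ X.left.presheaf.map (homOfLE inf_le_left).op s)
      (Φlm : R ⊗[k] Γ(X.left, V₀ ⊓ V₀) →ₐ[R] R ⊗[k] Γ(X.left, V₀ ⊓ V₀ ⊓ V₀))
      (_ : ∀ a s, Φlm (a ⊗ₜ s) = a ⊗ₜ X.left.presheaf.map
        (homOfLE (le_inf (inf_le_left.trans inf_le_right) inf_le_right)).op s)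
      (Φjm : R ⊗[k] Γ(X.left, V₀ ⊓ V₀) →ₐ[R] R ⊗[k] Γ(X.left, V₀ ⊓ V₀ ⊓ V₀))
      (_ : ∀ a s, Φjm (a ⊗ₜ s) = a ⊗ₜ X.left.presheaf.map
        (homOfLE (le_inf (inf_le_left.trans inf_le_left) inf_le_right)).op s)
      (ρjl ρlm ρjm : R ⊗[k] Γ(X.left, V₀ ⊓ V₀ ⊓ V₀) ≃ₐ[R] R ⊗[k] Γ(X.left, V₀ ⊓ V₀ ⊓ V₀)),
      (∀ x, ρjl (Φjl x) = Φjl (ψ x)) → (∀ x, ρlm (Φlm x) = Φlm (ψ x)) →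
      (∀ x, ρjm (Φjm x) = Φjm (ψ x)) → ρlm * ρjl = ρjm) (x : R ⊗[k] Γ(X.left, V₀ ⊓ V₀)) :
    ψ x = x := by
  have hle : V₀ ⊓ V₀ ⊓ V₀ ≤ V₀ ⊓ V₀ := inf_le_left
  have hge : V₀ ⊓ V₀ ≤ V₀ ⊓ V₀ ⊓ V₀ := le_inf le_rfl inf_le_left
  obtain ⟨Φ, hΦ⟩ := exists_baseChangeMap (A' := R) halg (V₀ ⊓ V₀) (V₀ ⊓ V₀ ⊓ V₀) hle
  obtain ⟨Φ', hΦ'⟩ := exists_baseChangeMap (A' := R) halg (V₀ ⊓ V₀ ⊓ V₀) (V₀ ⊓ V₀) hge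
  obtain ⟨ρ, hρ, -⟩ := exists_algEquiv_restrict (A' := R) halg 𝔫 (V := V₀ ⊓ V₀) (W := V₀ ⊓ V₀ ⊓ V₀) h00 f hf
    hle h𝔫 ψ hψ (Φ := Φ) hΦ
  have hρρ : ρ * ρ = ρ := hcoc Φ hΦ Φ hΦ Φ hΦ ρ ρ ρ hρ hρ hρ
  have hρ1 : ρ = 1 := mul_eq_left.mp hρρ
  apply baseChangeMap_injective_of_le_of_le hle hge hΦ hΦ'
  rw [← hρ, hρ1, AlgEquiv.one_apply]

end Literature.AlgebraicGeometry.Deformation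

end
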